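import Literature.Geometry.Lorentzian.TeukolskyWronskianBound
import Literature.Geometry.Lorentzian.TeukolskyRealAxisModeStabilityFinal
import Literature.Geometry.Lorentzian.KerrSeparatedPotential
import Literature.Analysis.ODE.LinearSecondOrder
import Mathlib.Analysis.Calculus.MeanValue
import Mathlib.Analysis.SpecialFunctions.Pow.Deriv
import Mathlib.Analysis.Complex.RealDeriv
import HarnessLib

/-!
# Quantitative real-axis mode stability (Teixeira da Costa 2020, Thm. 5.1, `|a| < M`):
# proofs, part 1 — constancy and non-vanishing of the Wronskian (Remark 5.1, Corollary 5.1)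

First proved inputs for the named fact
`Literature.Geometry.Lorentzian.Kerr.Costa2019_wronskianBound_subextremal`
(`TeukolskyWronskianBound.lean` — see that file for the exact statement and its history;
R. Teixeira da Costa, *Mode stability for the Teukolsky equation on extremal and subextremal Kerr
spacetimes*, Commun. Math. Phys. 378 (2020) 705–781 = arXiv:1910.02854 [Costa2019]). The fact is
the subextremal (`|a| < M`) slice of her quantitative mode stability, Thm. 5.1: a lower bound
`1 ≤ G(C, M, s) |𝔚|²` for the Wronskian of the normalised solutions `R_𝓗`, `R_𝓘` of Def. 2.3 on a
bounded range of real frequencies (away from `ω = 0` and the thresholds excluded there), UNIFORM in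
`a ∈ (−M, M)`. This file proves the qualitative layer underneath it:

* `Costa2019.hasDerivAt_radialWronskian_zero`, `Costa2019.radialWronskian_eq` — **Remark 5.1**:
  the Wronskian `𝔚 = Δ^{1+s}(R_𝓗 R_𝓘' − R_𝓘 R_𝓗')` of two classical solutions of the homogeneous
  radial Teukolsky ODE is constant on `(r₊, ∞)` (Abel's identity for
  `Δ^{-s} d/dr (Δ^{s+1} d/dr) + V`: `d/dr [Δ^{1+s} W] = Δ^s [R_𝓗 (ΔR_𝓘'' + 2(s+1)(r−M)R_𝓘') − (𝓗 ↔ 𝓘)]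
  = Δ^s [−V R_𝓗 R_𝓘 + V R_𝓘 R_𝓗] = 0`); `Costa2019.radialWronskian_forall_iff_at`: hence any
  property of `𝔚(r)` — in particular the fact's lower bound — holds at every radius `r > r₊` iff
  it holds at one radius of one's choosing.
* `Costa2019.radial_eq_zero_of_data`, `Costa2019.radial_eq_smul_of_wronskian_eq_zero` —
  uniqueness for the radial ODE on `(r₊, ∞)` (normal form `R'' = pR' + qR`, `p`, `q` continuous,
  `Literature.Analysis.ODE.eqOn_of_solution_Ioo`) and "vanishing Wronskian ⇒ proportional".
* `Costa2019.exists_ne_zero_of_isNormalisedInfinitySolution`,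
  `Costa2019.isOutgoingAtInfinity_of_eq_const_mul`, `Costa2019.normalisedHorizon_not_forall_eq_zero`
  — elementary consequences of the normalisations of Def. 2.3 (`R_𝓘 ≠ 0` far out since
  `|c₀| = 1`; `R_𝓗 ≢ 0` since `|f(r₊)| ≠ 0`).
* `Costa2019.radialWronskian_ne_zero` — **Corollary 5.1** (of Theorem 4.1, here the tree's
  proved `Costa2019_realAxisModeStability_holds`) for `|a| < M`: for `s ∈ ½ℤ`, `m − s ∈ ℤ`,
  real `ω ≠ 0`, any real `λ`, the Wronskian of a horizon-normalised and an infinity-normalised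
  radial solution vanishes nowhere; `Costa2019.wronskianBound_fixed`: so for each FIXED
  configuration there is `G > 0` with `1 ≤ G |𝔚(r)|²` for all `r > r₊`.

What remains for the fact itself is exactly its quantitative content: `G` depending on
`(M, s, C)` only, uniformly in `a ∈ (−M, M)` — §5.3–5.4 of the source (Prop. 5.4, Lemma 5.6,
(5.x)) with explicit constants; not in this file.

Everything here is proved; theorems only (D-0026).

## References
* R. Teixeira da Costa, CMP 378 (2020) 705–781, arXiv:1910.02854, Def. 2.3, Def. 5.1,
  Remark 5.1, Corollary 5.1, Theorem 5.1, Proposition 6.3. [Costa2019]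
* P. Hartman, *Ordinary Differential Equations*, SIAM Classics 38 (2002), Ch. IV Lemma 1.1
  (uniqueness). [Hartman2002]
-/

noncomputable section

open Complex Set

namespace Literature.Geometry.Lorentzian.Kerr

namespace Costa2019

/-! ### Remark 5.1: the Wronskian of two radial solutions is constant in `r` -/

/-- `Δ^{1+s} = Δ^s · Δ` on `r > r₊` (where `Δ > 0`). [folklore] -/
theorem delta_rpow_one_add {M a : ℝ} (ha : |a| ≤ M) (s : ℝ) {r : ℝ} (hr : rPlus M a < r) :
    delta M a r ^ (1 + s) = delta M a r ^ s * delta M a r := by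
  rw [Real.rpow_add (delta_pos ha hr), Real.rpow_one, mul_comm]

/-- `d/dr Δ^{p} = 2(r − M) · p · Δ^{p−1}` on `r > r₊`. [folklore] -/
theorem hasDerivAt_delta_rpow {M a : ℝ} (ha : |a| ≤ M) (p : ℝ) {r : ℝ} (hr : rPlus M a < r) :
    HasDerivAt (fun y => delta M a y ^ p) (2 * (r - M) * p * delta M a r ^ (p - 1)) r :=
  (hasDerivAt_delta M a r).rpow_const (Or.inl (delta_pos ha hr).ne')

/-- **Remark 5.1 (differential form).** For two classical solutions `R_𝓗`, `R_𝓘` of the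
homogeneous radial Teukolsky ODE with first derivatives `R_𝓗'`, `R_𝓘'` on `(r₊, ∞)`, the function
`r ↦ Δ^{1+s}(R_𝓗 R_𝓘' − R_𝓘 R_𝓗')` has derivative `0` at every `r > r₊`.
[cite: Costa2019, Remark 5.1] -/
theorem hasDerivAt_radialWronskian_zero {M a s ω m lam : ℝ} (ha : |a| ≤ M) {RH RI RH' RH'' RI' RI'' : ℝ → ℂ}
    (hRH : ∀ r : ℝ, rPlus M a < r →
      HasDerivAt RH (RH' r) r ∧ HasDerivAt RH' (RH'' r) r ∧
        (delta M a r : ℂ) * RH'' r + 2 * ((s + 1 : ℝ) : ℂ) * ((r - M : ℝ) : ℂ) * RH' r +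
          ((((radialK a ω m r ^ 2 : ℝ) : ℂ) -
                2 * I * (s : ℂ) * ((r - M : ℝ) : ℂ) * (radialK a ω m r : ℂ)) / (delta M a r : ℂ) +
              4 * I * (s : ℂ) * (ω : ℂ) * (r : ℂ) - (lam : ℂ) - ((a ^ 2 * ω ^ 2 : ℝ) : ℂ) +
              ((2 * a * m * ω : ℝ) : ℂ)) * RH r = 0)
    (hRI : ∀ r : ℝ, rPlus M a < r →
      HasDerivAt RI (RI' r) r ∧ HasDerivAt RI' (RI'' r) r ∧
        (delta M a r : ℂ) * RI'' r + 2 * ((s + 1 : ℝ) : ℂ) * ((r - M : ℝ) : ℂ) * RI' r +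
          ((((radialK a ω m r ^ 2 : ℝ) : ℂ) -
                2 * I * (s : ℂ) * ((r - M : ℝ) : ℂ) * (radialK a ω m r : ℂ)) / (delta M a r : ℂ) +
              4 * I * (s : ℂ) * (ω : ℂ) * (r : ℂ) - (lam : ℂ) - ((a ^ 2 * ω ^ 2 : ℝ) : ℂ) +
              ((2 * a * m * ω : ℝ) : ℂ)) * RI r = 0)
    {r : ℝ} (hr : rPlus M a < r) :
    HasDerivAt (fun y => ((delta M a y ^ (1 + s) : ℝ) : ℂ) * (RH y * RI' y - RI y * RH' y)) 0 r := by
  obtain ⟨hd1, hd2, heq⟩ := hRH r hr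
  obtain ⟨he1, he2, heqI⟩ := hRI r hr
  have hΔ : 0 < delta M a r := delta_pos ha hr
  have hg : HasDerivAt (fun y => ((delta M a y ^ (1 + s) : ℝ) : ℂ))
      (((2 * (r - M) * (1 + s) * delta M a r ^ s : ℝ) : ℂ)) r := by
    have h := (hasDerivAt_delta_rpow ha (1 + s) hr).ofReal_comp
    rw [add_sub_cancel_left] at h
    exact h
  have hw : HasDerivAt (fun y => RH y * RI' y - RI y * RH' y) (RH r * RI'' r - RI r * RH'' r) r := by
    have h := (hd1.mul he2).sub (he1.mul hd2)
    refine h.congr_deriv ?_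
    ring
  refine (hg.mul hw).congr_deriv ?_
  rw [delta_rpow_one_add ha s hr]
  push_cast at heq heqI ⊢
  linear_combination (((delta M a r ^ s : ℝ) : ℂ) * RH r) * heqI -
    (((delta M a r ^ s : ℝ) : ℂ) * RI r) * heq

/-- **Remark 5.1.** The Wronskian `𝔚 = Δ^{1+s}(R_𝓗 R_𝓘' − R_𝓘 R_𝓗')` (`radialWronskian`, with
Mathlib's `deriv`) of two classical solutions of the homogeneous radial Teukolsky ODE takes the
same value at any two radii `r₁, r₂ > r₊` ("`𝔚` is independent of `r*`"; `|a| ≤ M`).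
[cite: Costa2019, Remark 5.1] -/
theorem radialWronskian_eq {M a s ω m lam : ℝ} (ha : |a| ≤ M) {RH RI : ℝ → ℂ}
    (hH : IsRadialTeukolskySolution M a s ω m lam RH) (hI : IsRadialTeukolskySolution M a s ω m lam RI)
    {r₁ r₂ : ℝ} (h₁ : rPlus M a < r₁) (h₂ : rPlus M a < r₂) :
    radialWronskian M a s RH RI r₁ = radialWronskian M a s RH RI r₂ := by
  obtain ⟨RH', RH'', hRH⟩ := hH
  obtain ⟨RI', RI'', hRI⟩ := hI
  set F : ℝ → ℂ := fun y => ((delta M a y ^ (1 + s) : ℝ) : ℂ) * (RH y * RI' y - RI y * RH' y)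
    with hF
  have hWF : ∀ r, rPlus M a < r → radialWronskian M a s RH RI r = F r := by
    intro r hr
    rw [radialWronskian_apply, (hRH r hr).1.deriv, (hRI r hr).1.deriv]
  have hderiv : ∀ x ∈ Ioi (rPlus M a), HasDerivWithinAt F ((fun _ => (0 : ℂ)) x) (Ioi (rPlus M a)) x :=
    fun x hx => (hasDerivAt_radialWronskian_zero ha hRH hRI hx).hasDerivWithinAt
  have h := (convex_Ioi (rPlus M a)).norm_image_sub_le_of_norm_hasDerivWithin_le (C := 0) hderiv
    (fun x _ => by simp) h₁ h₂
  rw [zero_mul, norm_le_zero_iff, sub_eq_zero] at h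
  rw [hWF r₁ h₁, hWF r₂ h₂, h]

/-- The Wronskian of two radial solutions vanishes at one radius `> r₊` iff it vanishes at every
such radius. [cite: Costa2019, Remark 5.1] -/
theorem radialWronskian_eq_zero_iff {M a s ω m lam : ℝ} (ha : |a| ≤ M) {RH RI : ℝ → ℂ}
    (hH : IsRadialTeukolskySolution M a s ω m lam RH) (hI : IsRadialTeukolskySolution M a s ω m lam RI)
    {r₁ : ℝ} (h₁ : rPlus M a < r₁) :
    radialWronskian M a s RH RI r₁ = 0 ↔ ∀ r, rPlus M a < r → radialWronskian M a s RH RI r = 0 :=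
  ⟨fun h _ hr => (radialWronskian_eq ha hH hI hr h₁).trans h, fun h => h r₁ h₁⟩

/-! ### One radius suffices -/

/-- **One radius suffices (pointwise form of Wronskian bounds).** For two classical radial
solutions (`|a| ≤ M`) and any property `Φ` of a complex number, `Φ(𝔚(r))` holds at every radius
`r > r₊` iff it holds at ONE radius `ρ > r₊` chosen in advance, the Wronskian being constant
(Remark 5.1). In particular the lower bound `1 ≤ G·|𝔚(r)|²` of the named fact
`Costa2019_wronskianBound_subextremal` need only be established at one radius of one's choosing
(take `Φ w := 1 ≤ G·‖w‖²`). [cite: Costa2019, Remark 5.1] -/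
theorem radialWronskian_forall_iff_at {M a s ω m lam : ℝ} (ha : |a| ≤ M) {RH RI : ℝ → ℂ}
    (hH : IsRadialTeukolskySolution M a s ω m lam RH) (hI : IsRadialTeukolskySolution M a s ω m lam RI)
    (Φ : ℂ → Prop) {ρ : ℝ} (hρ : rPlus M a < ρ) :
    (∀ r, rPlus M a < r → Φ (radialWronskian M a s RH RI r)) ↔ Φ (radialWronskian M a s RH RI ρ) :=
  ⟨fun h => h ρ hρ, fun h _ hr => by rwa [radialWronskian_eq ha hH hI hr hρ]⟩

/-! ### Uniqueness for the radial ODE; linear dependence from a vanishing Wronskian -/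

/-- **Uniqueness for the radial Teukolsky ODE.** A classical solution on `(r₊, ∞)` (given with
its first two derivatives) whose value and first derivative vanish at one radius `t₀ > r₊`
vanishes identically, together with its derivative (`|a| ≤ M`; the equation is
`R'' = p R' + q R` with `p = −2(s+1)(r−M)/Δ`, `q = −V/Δ` continuous on `(r₊, ∞)`, Grönwall).
[cite: Costa2019, §2.2.3 (classical solutions) with Hartman2002, Ch. IV Lemma 1.1] -/
theorem radial_eq_zero_of_data {M a s ω m lam : ℝ} (ha : |a| ≤ M) {R R' R'' : ℝ → ℂ}
    (hR : ∀ r : ℝ, rPlus M a < r →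
      HasDerivAt R (R' r) r ∧ HasDerivAt R' (R'' r) r ∧
        (delta M a r : ℂ) * R'' r + 2 * ((s + 1 : ℝ) : ℂ) * ((r - M : ℝ) : ℂ) * R' r +
          ((((radialK a ω m r ^ 2 : ℝ) : ℂ) -
                2 * I * (s : ℂ) * ((r - M : ℝ) : ℂ) * (radialK a ω m r : ℂ)) / (delta M a r : ℂ) +
              4 * I * (s : ℂ) * (ω : ℂ) * (r : ℂ) - (lam : ℂ) - ((a ^ 2 * ω ^ 2 : ℝ) : ℂ) +
              ((2 * a * m * ω : ℝ) : ℂ)) * R r = 0)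
    {t₀ : ℝ} (ht₀ : rPlus M a < t₀) (h0 : R t₀ = 0) (h1 : R' t₀ = 0) :
    ∀ r, rPlus M a < r → R r = 0 ∧ R' r = 0 := by
  -- the coefficients of the normal form `R'' = p R' + q R`
  set V : ℝ → ℂ := fun r =>
    (((radialK a ω m r ^ 2 : ℝ) : ℂ) -
          2 * I * (s : ℂ) * ((r - M : ℝ) : ℂ) * (radialK a ω m r : ℂ)) / (delta M a r : ℂ) +
        4 * I * (s : ℂ) * (ω : ℂ) * (r : ℂ) - (lam : ℂ) - ((a ^ 2 * ω ^ 2 : ℝ) : ℂ) +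
      ((2 * a * m * ω : ℝ) : ℂ) with hV
  set p : ℝ → ℂ := fun r => -(2 * ((s + 1 : ℝ) : ℂ) * ((r - M : ℝ) : ℂ)) / (delta M a r : ℂ)
    with hp
  set q : ℝ → ℂ := fun r => -V r / (delta M a r : ℂ) with hq
  have hΔ0 : ∀ r ∈ Ioi (rPlus M a), (delta M a r : ℂ) ≠ 0 := fun r hr => by
    exact_mod_cast (delta_pos ha hr).ne'
  -- continuity of the coefficients on `(r₊, ∞)`
  have hΔc : Continuous fun r : ℝ => (delta M a r : ℂ) :=
    Complex.continuous_ofReal.comp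
      (show Continuous fun r : ℝ => r ^ 2 - 2 * M * r + a ^ 2 by fun_prop)
  have hK1 : Continuous (radialK a ω m) :=
    show Continuous fun r : ℝ => ω * (r ^ 2 + a ^ 2) - a * m by fun_prop
  have hKc : Continuous fun r => (radialK a ω m r : ℂ) := Complex.continuous_ofReal.comp hK1
  have hK2c : Continuous fun r => ((radialK a ω m r ^ 2 : ℝ) : ℂ) :=
    Complex.continuous_ofReal.comp (hK1.pow 2)
  have hrM : Continuous fun r : ℝ => ((r - M : ℝ) : ℂ) :=
    Complex.continuous_ofReal.comp (continuous_id.sub continuous_const)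
  have hrc : Continuous fun r : ℝ => (r : ℂ) := Complex.continuous_ofReal
  have hVc : ContinuousOn V (Ioi (rPlus M a)) := by
    refine ContinuousOn.add (ContinuousOn.sub (ContinuousOn.sub (ContinuousOn.add
      (ContinuousOn.div ?_ hΔc.continuousOn hΔ0) ?_) continuousOn_const) continuousOn_const)
      continuousOn_const
    · exact (hK2c.sub (((continuous_const.mul hrM)).mul hKc)).continuousOn
    · exact (continuous_const.mul hrc).continuousOn
  have hpc : ContinuousOn p (Ioi (rPlus M a)) :=
    (continuous_const.mul hrM).neg.continuousOn.div hΔc.continuousOn hΔ0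
  have hqc : ContinuousOn q (Ioi (rPlus M a)) := hVc.neg.div hΔc.continuousOn hΔ0
  -- the equation in normal form
  have hsol : ∀ t ∈ Ioi (rPlus M a),
      HasDerivAt R (R' t) t ∧ HasDerivAt R' (p t * R' t + q t * R t) t := by
    intro t ht
    obtain ⟨hd1, hd2, hode⟩ := hR t ht
    have hΔt := hΔ0 t ht
    have h3 : (delta M a t : ℂ) * R'' t = -(2 * ((s + 1 : ℝ) : ℂ) * ((t - M : ℝ) : ℂ) * R' t +
        V t * R t) := by
      simp only [hV]
      linear_combination hode
    have h4 : R'' t = p t * R' t + q t * R t := by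
      simp only [hp, hq]
      field_simp
      linear_combination h3
    exact ⟨hd1, h4 ▸ hd2⟩
  -- uniqueness on `(r₊, b)` for every `b`
  intro r hr
  set b : ℝ := max r t₀ + 1 with hb
  have hsub : Ioo (rPlus M a) b ⊆ Ioi (rPlus M a) := fun x hx => hx.1
  have hzero : ∀ t ∈ Ioo (rPlus M a) b,
      HasDerivAt (fun _ : ℝ => (0 : ℂ)) ((fun _ : ℝ => (0 : ℂ)) t) t ∧
        HasDerivAt (fun _ : ℝ => (0 : ℂ)) (p t * (fun _ : ℝ => (0 : ℂ)) t +
          q t * (fun _ : ℝ => (0 : ℂ)) t) t := by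
    intro t _
    refine ⟨hasDerivAt_const t 0, ?_⟩
    simpa using hasDerivAt_const t (0 : ℂ)
  have ht₀b : t₀ ∈ Ioo (rPlus M a) b := ⟨ht₀, by rw [hb]; linarith [le_max_right r t₀]⟩
  have hrb : r ∈ Ioo (rPlus M a) b := ⟨hr, by rw [hb]; linarith [le_max_left r t₀]⟩
  have h := Literature.Analysis.ODE.eqOn_of_solution_Ioo (hpc.mono hsub) (hqc.mono hsub) ht₀b
    (fun t ht => hsol t (hsub ht)) hzero h0 h1
  exact ⟨h.1 hrb, h.2 hrb⟩

/-- **Two radial solutions with vanishing Wronskian are proportional.** If `R_𝓗`, `R_𝓘` solve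
the homogeneous radial Teukolsky ODE on `(r₊, ∞)`, `R_𝓘(t₀) ≠ 0` and
`R_𝓗 R_𝓘' − R_𝓘 R_𝓗' = 0` at `t₀ > r₊`, then `R_𝓗 = (R_𝓗(t₀)/R_𝓘(t₀)) · R_𝓘` on `(r₊, ∞)`
(uniqueness applied to the difference). [cite: Costa2019, Remark 5.1 ("linearly dependent iff
𝔚 = 0"), with Hartman2002, Ch. IV Lemma 1.1] -/
theorem radial_eq_smul_of_wronskian_eq_zero {M a s ω m lam : ℝ} (ha : |a| ≤ M)
    {RH RH' RH'' RI RI' RI'' : ℝ → ℂ}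
    (hRH : ∀ r : ℝ, rPlus M a < r →
      HasDerivAt RH (RH' r) r ∧ HasDerivAt RH' (RH'' r) r ∧
        (delta M a r : ℂ) * RH'' r + 2 * ((s + 1 : ℝ) : ℂ) * ((r - M : ℝ) : ℂ) * RH' r +
          ((((radialK a ω m r ^ 2 : ℝ) : ℂ) -
                2 * I * (s : ℂ) * ((r - M : ℝ) : ℂ) * (radialK a ω m r : ℂ)) / (delta M a r : ℂ) +
              4 * I * (s : ℂ) * (ω : ℂ) * (r : ℂ) - (lam : ℂ) - ((a ^ 2 * ω ^ 2 : ℝ) : ℂ) +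
              ((2 * a * m * ω : ℝ) : ℂ)) * RH r = 0)
    (hRI : ∀ r : ℝ, rPlus M a < r →
      HasDerivAt RI (RI' r) r ∧ HasDerivAt RI' (RI'' r) r ∧
        (delta M a r : ℂ) * RI'' r + 2 * ((s + 1 : ℝ) : ℂ) * ((r - M : ℝ) : ℂ) * RI' r +
          ((((radialK a ω m r ^ 2 : ℝ) : ℂ) -
                2 * I * (s : ℂ) * ((r - M : ℝ) : ℂ) * (radialK a ω m r : ℂ)) / (delta M a r : ℂ) +
              4 * I * (s : ℂ) * (ω : ℂ) * (r : ℂ) - (lam : ℂ) - ((a ^ 2 * ω ^ 2 : ℝ) : ℂ) +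
              ((2 * a * m * ω : ℝ) : ℂ)) * RI r = 0)
    {t₀ : ℝ} (ht₀ : rPlus M a < t₀) (hI0 : RI t₀ ≠ 0)
    (hW : RH t₀ * RI' t₀ - RI t₀ * RH' t₀ = 0) :
    ∀ r, rPlus M a < r → RH r = RH t₀ / RI t₀ * RI r := by
  set c : ℂ := RH t₀ / RI t₀ with hc
  have hY : ∀ r : ℝ, rPlus M a < r →
      HasDerivAt (fun y => RH y - c * RI y) (RH' r - c * RI' r) r ∧
        HasDerivAt (fun y => RH' y - c * RI' y) (RH'' r - c * RI'' r) r ∧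
        (delta M a r : ℂ) * (RH'' r - c * RI'' r) +
            2 * ((s + 1 : ℝ) : ℂ) * ((r - M : ℝ) : ℂ) * (RH' r - c * RI' r) +
          ((((radialK a ω m r ^ 2 : ℝ) : ℂ) -
                2 * I * (s : ℂ) * ((r - M : ℝ) : ℂ) * (radialK a ω m r : ℂ)) / (delta M a r : ℂ) +
              4 * I * (s : ℂ) * (ω : ℂ) * (r : ℂ) - (lam : ℂ) - ((a ^ 2 * ω ^ 2 : ℝ) : ℂ) +
              ((2 * a * m * ω : ℝ) : ℂ)) * (RH r - c * RI r) = 0 := by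
    intro r hr
    obtain ⟨h1, h2, h3⟩ := hRH r hr
    obtain ⟨e1, e2, e3⟩ := hRI r hr
    exact ⟨h1.sub (e1.const_mul c), h2.sub (e2.const_mul c), by linear_combination h3 - c * e3⟩
  have h0 : RH t₀ - c * RI t₀ = 0 := by
    rw [hc, div_mul_cancel₀ _ hI0, sub_self]
  have h1 : RH' t₀ - c * RI' t₀ = 0 := by
    rw [hc]
    field_simp
    linear_combination -hW
  intro r hr
  exact sub_eq_zero.1 ((radial_eq_zero_of_data ha hY ht₀ h0 h1) r hr).1

/-! ### Consequences of the normalisations of Def. 2.3 -/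

/-- A solution normalised at `𝓘⁺` (Def. 2.3: `R ∼ e^{iωr} r^{2iMω−2s−1}` with `|c₀| = 1`) does
not vanish at some radius beyond any prescribed `X` (the leading term dominates for large `r`).
[cite: Costa2019, Definition 2.3] -/
theorem exists_ne_zero_of_isNormalisedInfinitySolution {M s ω : ℝ} {R : ℝ → ℂ}
    (h : IsNormalisedInfinitySolution M s ω R) (X : ℝ) : ∃ t₀, X < t₀ ∧ R t₀ ≠ 0 := by
  obtain ⟨c, hc0, hN⟩ := h
  obtain ⟨C, r₀, hC⟩ := hN 1 le_rfl
  set t₀ : ℝ := max (max r₀ 1) (max (X + 1) (‖c 1‖ + |C| + 2)) with ht₀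
  have h1 : 1 ≤ t₀ := (le_max_right _ _).trans (le_max_left _ _)
  have hpos : 0 < t₀ := one_pos.trans_le h1
  have hr₀ : r₀ ≤ t₀ := (le_max_left _ _).trans (le_max_left _ _)
  have hX : X < t₀ := by
    have : X + 1 ≤ t₀ := (le_max_left _ _).trans (le_max_right _ _)
    linarith
  have hbig : ‖c 1‖ + |C| + 2 ≤ t₀ := (le_max_right _ _).trans (le_max_right _ _)
  refine ⟨t₀, hX, fun hz => ?_⟩
  have key := hC t₀ hr₀
  rw [hz, zero_sub, norm_neg, Finset.sum_range_succ, Finset.sum_range_succ,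
    Finset.sum_range_zero, zero_add, norm_mul, Complex.norm_exp] at key
  have hre : (I * ω * t₀ + 2 * I * M * ω * (Real.log t₀ : ℝ)).re = 0 := by
    simp [Complex.mul_re, Complex.I_re, Complex.I_im]
  rw [hre, Real.exp_zero, one_mul] at key
  -- the exponents
  set e : ℝ := -(2 * s) - ((0 : ℕ) : ℝ) - 1 with he
  have he1 : -(2 * s) - ((1 : ℕ) : ℝ) - 1 = e - 1 := by rw [he]; push_cast; ring
  have he2 : -(2 * s) - ((1 : ℕ) : ℝ) - 2 = e - 2 := by rw [he]; push_cast; ring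
  rw [he1, he2] at key
  have hA : 0 < t₀ ^ e := Real.rpow_pos_of_pos hpos e
  set A : ℝ := t₀ ^ e with hAdef
  have hp1 : t₀ ^ (e - 1) = A / t₀ := by rw [Real.rpow_sub_one hpos.ne', hAdef]
  have hp2 : t₀ ^ (e - 2) = A / t₀ ^ (2 : ℝ) := by rw [Real.rpow_sub hpos, hAdef]
  rw [hp1, hp2, Real.rpow_two] at key
  -- lower bound for the two-term sum
  have hlow : A - ‖c 1‖ * (A / t₀) ≤ ‖c 0 * ((A : ℝ) : ℂ) + c 1 * ((A / t₀ : ℝ) : ℂ)‖ := by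
    have h2 : ‖c 0 * ((A : ℝ) : ℂ)‖ = A := by
      rw [norm_mul, hc0, one_mul, Complex.norm_real, Real.norm_eq_abs, abs_of_pos hA]
    have h3 : ‖c 1 * ((A / t₀ : ℝ) : ℂ)‖ = ‖c 1‖ * (A / t₀) := by
      rw [norm_mul, Complex.norm_real, Real.norm_eq_abs, abs_of_pos (div_pos hA hpos)]
    have h4 := norm_sub_norm_le (c 0 * ((A : ℝ) : ℂ)) (-(c 1 * ((A / t₀ : ℝ) : ℂ)))
    rw [norm_neg, sub_neg_eq_add, h2, h3] at h4
    linarith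
  have hup : C * (A / t₀ ^ 2) ≤ |C| * (A / t₀) := by
    have h5 : A / t₀ ^ 2 ≤ A / t₀ := by
      rw [div_le_div_iff₀ (by positivity) hpos]
      nlinarith [mul_nonneg (mul_nonneg hA.le hpos.le) (sub_nonneg.2 h1)]
    calc C * (A / t₀ ^ 2) ≤ |C| * (A / t₀ ^ 2) :=
          mul_le_mul_of_nonneg_right (le_abs_self C) (by positivity)
      _ ≤ |C| * (A / t₀) := mul_le_mul_of_nonneg_left h5 (abs_nonneg C)
  have h6 : A - ‖c 1‖ * (A / t₀) ≤ |C| * (A / t₀) := (hlow.trans key).trans hup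
  -- divide by `A / t₀ > 0`: `t₀ ≤ ‖c 1‖ + |C|`
  have h7 : A * t₀ ≤ (‖c 1‖ + |C|) * A := by
    have h8 : A - ‖c 1‖ * (A / t₀) - |C| * (A / t₀) = (A * t₀ - (‖c 1‖ + |C|) * A) / t₀ := by
      field_simp
      ring
    have h9 : (A * t₀ - (‖c 1‖ + |C|) * A) / t₀ ≤ 0 := by rw [← h8]; linarith
    rw [div_le_iff₀ hpos, zero_mul] at h9
    linarith
  have h10 : t₀ ≤ ‖c 1‖ + |C| := le_of_mul_le_mul_right (by linarith [h7]) hA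
  linarith

/-- A solution normalised at `𝓘⁺` is outgoing at `𝓘⁺` (Def. 2.3 ⊆ Def. 2.4). [cite: Costa2019, Definitions 2.3–2.4] -/
theorem isOutgoingAtInfinity_of_normalised {M s ω : ℝ} {R : ℝ → ℂ}
    (h : IsNormalisedInfinitySolution M s ω R) : IsOutgoingAtInfinity M s ω R := by
  obtain ⟨c, -, hN⟩ := h
  exact ⟨c, hN⟩

/-- A solution normalised at `𝓗⁺` is outgoing at `𝓗⁺` (Def. 2.3 ⊆ Def. 2.4). [cite: Costa2019, Definitions 2.3–2.4] -/
theorem isOutgoingAtHorizon_of_normalised {M a s ω m : ℝ} {R : ℝ → ℂ}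
    (h : IsNormalisedHorizonSolution M a s ω m R) : IsOutgoingAtHorizon M a s ω m R := by
  obtain ⟨ε, hε, f, hf, hRf, -⟩ := h
  exact ⟨ε, hε, f, hf, hRf⟩

/-- A constant multiple (beyond some radius `X`) of a function outgoing at `𝓘⁺` is outgoing at
`𝓘⁺` (with the coefficients `c·c_k`). [cite: Costa2019, Definition 2.4] -/
theorem isOutgoingAtInfinity_of_eq_const_mul {M s ω : ℝ} {RI RH : ℝ → ℂ}
    (hI : IsOutgoingAtInfinity M s ω RI) (X : ℝ) (c : ℂ) (heq : ∀ r, X < r → RH r = c * RI r) :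
    IsOutgoingAtInfinity M s ω RH := by
  obtain ⟨d, hd⟩ := hI
  refine ⟨fun k => c * d k, fun N hN => ?_⟩
  obtain ⟨C, r₀, h⟩ := hd N hN
  refine ⟨‖c‖ * C, max r₀ (X + 1), fun r hr => ?_⟩
  have hrX : X < r := by linarith [le_max_right r₀ (X + 1)]
  have hr₀ : r₀ ≤ r := (le_max_left _ _).trans hr
  have hsum : ∑ k ∈ Finset.range (N + 1), c * d k * ((r ^ (-(2 * s) - (k : ℝ) - 1) : ℝ) : ℂ) =
      c * ∑ k ∈ Finset.range (N + 1), d k * ((r ^ (-(2 * s) - (k : ℝ) - 1) : ℝ) : ℂ) := by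
    rw [Finset.mul_sum]
    refine Finset.sum_congr rfl fun k _ => ?_
    ring
  rw [heq r hrX, hsum]
  have key := mul_le_mul_of_nonneg_left (h r hr₀) (norm_nonneg c)
  rw [← norm_mul, mul_sub, mul_left_comm c] at key
  simpa only [mul_assoc] using key

/-- A solution normalised at `𝓗⁺` does not vanish identically on `(r₊, ∞)`: its regular part
`f` is continuous at `r₊` with `|f(r₊)|·(r₊²+a²)^{1/2}(r₊−r₋)^s = 1`, while `f = 0` on
`(r₊, r₊ + ε)` would force `f(r₊) = 0`. [cite: Costa2019, Definition 2.3] -/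
theorem normalisedHorizon_not_forall_eq_zero {M a s ω m : ℝ} {R : ℝ → ℂ}
    (h : IsNormalisedHorizonSolution M a s ω m R) (hz : ∀ r, rPlus M a < r → R r = 0) : False := by
  obtain ⟨ε, hε, f, hf, hRf, hnorm⟩ := h
  have hcont : ContinuousAt f (rPlus M a) :=
    (hf.continuousOn.continuousWithinAt ⟨by linarith, by linarith⟩).continuousAt
      (Ioo_mem_nhds (by linarith) (by linarith))
  have hlim1 : Filter.Tendsto f (nhdsWithin (rPlus M a) (Ioi (rPlus M a))) (nhds (f (rPlus M a))) :=
    hcont.tendsto.mono_left nhdsWithin_le_nhds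
  have hev : f =ᶠ[nhdsWithin (rPlus M a) (Ioi (rPlus M a))] fun _ => (0 : ℂ) := by
    have hmem : Ioo (rPlus M a) (rPlus M a + ε) ∈ nhdsWithin (rPlus M a) (Ioi (rPlus M a)) :=
      Ioo_mem_nhdsGT (by linarith)
    filter_upwards [hmem] with r hr
    rw [← hRf r hr, hz r hr.1, zero_mul]
  have hlim0 : Filter.Tendsto f (nhdsWithin (rPlus M a) (Ioi (rPlus M a))) (nhds 0) :=
    tendsto_const_nhds.congr' hev.symm
  have hf0 : f (rPlus M a) = 0 := tendsto_nhds_unique hlim1 hlim0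
  rw [hf0, norm_zero, zero_mul] at hnorm
  exact zero_ne_one hnorm

/-! ### Corollary 5.1 for normalised pairs: the Wronskian does not vanish -/

/-- **Corollary 5.1 (of Theorem 4.1), subextremal case, for the normalised solutions of
Def. 2.3.** For `M > 0`, `|a| < M`, `s ∈ ½ℤ`, `m − s ∈ ℤ`, real `ω ≠ 0` and any real `λ`: if
`R_𝓗` is a classical radial solution normalised at `𝓗⁺` and `R_𝓘` one normalised at `𝓘⁺`, then
their Wronskian `𝔚 = Δ^{1+s}(R_𝓗 R_𝓘' − R_𝓘 R_𝓗')` vanishes nowhere on `(r₊, ∞)`. Proof as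
printed: `𝔚 = 0` makes `R_𝓗`, `R_𝓘` proportional (the Wronskian is constant, `R_𝓘 ≠ 0` far
out), so `R_𝓗` is outgoing at both ends and vanishes by Theorem 4.1
(`Costa2019_realAxisModeStability_holds`), contradicting its normalisation at `𝓗⁺`.
[cite: Costa2019, Corollary 5.1] -/
theorem radialWronskian_ne_zero {M a s ω m lam : ℝ} (hM : 0 < M) (ha : |a| < M)
    (h2s : ∃ k : ℤ, 2 * s = k) (hms : ∃ k : ℤ, m - s = k) (hω : ω ≠ 0) {RH RI : ℝ → ℂ}
    (hH : IsRadialTeukolskySolution M a s ω m lam RH) (hnH : IsNormalisedHorizonSolution M a s ω m RH)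
    (hI : IsRadialTeukolskySolution M a s ω m lam RI) (hnI : IsNormalisedInfinitySolution M s ω RI) :
    ∀ r, rPlus M a < r → radialWronskian M a s RH RI r ≠ 0 := by
  intro r hr hzero
  -- a radius where `R_𝓘 ≠ 0`; the Wronskian vanishes there too
  obtain ⟨t₀, ht₀, hI0⟩ := exists_ne_zero_of_isNormalisedInfinitySolution hnI (rPlus M a)
  have hW0 : radialWronskian M a s RH RI t₀ = 0 :=
    (radialWronskian_eq_zero_iff ha.le hH hI hr).1 hzero t₀ ht₀
  obtain ⟨RH', RH'', hRH⟩ := hH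
  obtain ⟨RI', RI'', hRI⟩ := hI
  have hW0' : RH t₀ * RI' t₀ - RI t₀ * RH' t₀ = 0 := by
    rw [radialWronskian_apply, (hRH t₀ ht₀).1.deriv, (hRI t₀ ht₀).1.deriv, mul_eq_zero] at hW0
    refine hW0.resolve_left ?_
    exact_mod_cast (Real.rpow_pos_of_pos (delta_pos ha.le ht₀) (1 + s)).ne'
  -- hence `R_𝓗 = c · R_𝓘` on `(r₊, ∞)`
  have hprop := radial_eq_smul_of_wronskian_eq_zero ha.le hRH hRI ht₀ hI0 hW0'
  -- so `R_𝓗` is outgoing at both ends, and vanishes by Theorem 4.1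
  have hHinf : IsOutgoingAtInfinity M s ω RH :=
    isOutgoingAtInfinity_of_eq_const_mul (isOutgoingAtInfinity_of_normalised hnI) (rPlus M a) _
      hprop
  have hzeroH : ∀ x, rPlus M a < x → RH x = 0 :=
    Costa2019_realAxisModeStability_holds M a s ω m lam hM ha h2s hms hω RH ⟨RH', RH'', hRH⟩
      (isOutgoingAtHorizon_of_normalised hnH) hHinf
  exact normalisedHorizon_not_forall_eq_zero hnH hzeroH

/-- **The Wronskian bound for each fixed configuration** (the qualitative content of the fact,
Cor. 5.1 ⊕ Remark 5.1): for fixed admissible parameters with `|a| < M` and a fixed normalised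
pair `(R_𝓗, R_𝓘)` there is `G > 0` with `1 ≤ G·|𝔚(r)|²` for all `r > r₊` — namely
`G = |𝔚(r₊+1)|⁻²`, the Wronskian being a non-zero constant. What the named fact adds is that `G`
can be taken to depend on `(M, s)` and the frequency bound `C` only (uniformly in `a`, Thm. 5.1).
[cite: Costa2019, Corollary 5.1 and Remark 5.1] -/
theorem wronskianBound_fixed {M a s ω m lam : ℝ} (hM : 0 < M) (ha : |a| < M)
    (h2s : ∃ k : ℤ, 2 * s = k) (hms : ∃ k : ℤ, m - s = k) (hω : ω ≠ 0) {RH RI : ℝ → ℂ}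
    (hH : IsRadialTeukolskySolution M a s ω m lam RH) (hnH : IsNormalisedHorizonSolution M a s ω m RH)
    (hI : IsRadialTeukolskySolution M a s ω m lam RI) (hnI : IsNormalisedInfinitySolution M s ω RI) :
    ∃ G : ℝ, 0 < G ∧ ∀ r, rPlus M a < r → 1 ≤ G * ‖radialWronskian M a s RH RI r‖ ^ 2 := by
  have h1 : rPlus M a < rPlus M a + 1 := by linarith
  have hne := radialWronskian_ne_zero hM ha h2s hms hω hH hnH hI hnI _ h1
  have hpos : 0 < ‖radialWronskian M a s RH RI (rPlus M a + 1)‖ ^ 2 := by positivity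
  refine ⟨(‖radialWronskian M a s RH RI (rPlus M a + 1)‖ ^ 2)⁻¹, inv_pos.2 hpos, fun r hr => ?_⟩
  rw [radialWronskian_eq ha.le hH hI hr h1, inv_mul_cancel₀ hpos.ne']


end Costa2019

end Literature.Geometry.Lorentzian.Kerr

end
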